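import Summits.ResolutionOfSingularities.ResolutionOfSingularities.Theorems.PlanarCurveTrapEngine
import HarnessLib

/-!
# PlanarCurveTrapEngine2 — decomp-res node «CurveTrap» (lens-5 g26, critic row 177 CLEARED DECIDED +1), tree file
5/7 of the node

Content VERBATIM from the decomp-res lens-5 g26 node `HOME/decomp-res-lens-5/g26/CurveTrap.lean` (pin 39d382f9;
imports the landed tree only, carries nothing);
HOME = run/shared/lean/pub/decomp-res; critic row 177 CLEARED DECIDED +1; landing orders NODE §8 / INBOX :842 —
provenance, critic text and the lens header in full in the first
file of the node, `PlanarCurveTrapQPow`.  Namespace `…Theorems.CurveTrap`; `--supports stmt-ResolutionOfSingularities-31770`.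

## This file

Continuation 2/2 of `PlanarCurveTrapEngine` (same sections of the node, cut at the 400-line cap): carries
`not_isolatedTop_of_curve_pow`.

[WRITER NOTE (decomp-res writer g11): file split only (tree files ≤ 400 lines); namespace, sections, section
variables, the `open` block and every
declaration exactly as in the lens (the node's global dupNamespace-linter line is dropped — the library sets it);
ONE deletion (gate dedup
rule, critic :842 watch-list): the node's copy `eq_single_add_single_two` is NOT re-landed — it is LITERALLY the landed
`HauserPerlega2024.finsupp_eq_single_add_single` (`PointBlowupFlagTranslatedStep`, imported; namespace opened as in
the lens), cited by name at its two uses; no instance, no notation, no include/omit added.]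

(Sources: HauserPerlega2024 (characteristic-free resolution of surfaces by point blowups: Props. 3–4, the monomial
case); Hauser2010 Lectures VII–IX; CossartJannsenSaito2020 Ch. 5; Moh1987; BenitoVillamayor2014; the Hasse–Schmidt /
point-blowup flag formalism of the tree (Literature PointBlowupFlag*).)
-/

open MvPolynomial Finset
open Literature.AlgebraicGeometry.Resolution
open Literature.AlgebraicGeometry.Resolution.Hauser2010
open Literature.AlgebraicGeometry.Resolution.HauserPerlega2024
open Literature.AlgebraicGeometry.Resolution.PointBlowup
open Literature.AlgebraicGeometry.Resolution.WeightedBlowup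
open Summit.ResolutionOfSingularities.ResolutionOfSingularities.Theses
open Summit.ResolutionOfSingularities.ResolutionOfSingularities.Theorems.TightDefectClasses
open Summit.ResolutionOfSingularities.ResolutionOfSingularities.Theorems.TightDefectStrongWalks
open Summit.ResolutionOfSingularities.ResolutionOfSingularities.Theorems.ItineraryCutClasses
open Summit.ResolutionOfSingularities.ResolutionOfSingularities.Theorems.ProximityCut
open Summit.ResolutionOfSingularities.ResolutionOfSingularities.Theorems.ExitLaw
open Summit.ResolutionOfSingularities.ResolutionOfSingularities.Theorems.PlanarCut
open Summit.ResolutionOfSingularities.ResolutionOfSingularities.Theorems.CoefficientCut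
open Summit.ResolutionOfSingularities.ResolutionOfSingularities.Theorems.PlanarPort
open Summit.ResolutionOfSingularities.ResolutionOfSingularities.Theorems.SectionLift

namespace Summit.ResolutionOfSingularities.ResolutionOfSingularities.Theorems.CurveTrap

section Engine

variable {σ : Type} [DecidableEq σ] {L : Type} [Field L]
variable (p : ℕ) [Fact p.Prime] [CharP L p]

/-- **ISO-2 (curve form).** `↑G = (X_c + h(X_o))^q · R + Q` with `h(0) = 0`, `Q ∈ S_q` (`q = p^e`), `c ≠ o`: the origin
is NOT an isolated top point (approximate arcs `X_o ↦ T`, `X_c ↦ −h_{<n}(T)` kill `J` to every order). [new] [folklore] -/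
theorem not_isolatedTop_of_curve_pow [Fintype σ] (e : ℕ) {G : MvPolynomial σ L} {c o : σ} (hco : c ≠ o)
    {h₁ : PowerSeries L} (hh : PowerSeries.constantCoeff h₁ = 0) {R Q : MvPowerSeries σ L}
    (hG : (G : MvPowerSeries σ L) =
      (MvPowerSeries.X c + PowerSeries.subst (MvPowerSeries.X o : MvPowerSeries σ L) h₁) ^ p ^ e * R + Q)
    (hQ : IsQPow (p ^ e) Q) : ¬ IsolatedTop (p ^ e) G := by
  classical
  have hq0 : p ^ e ≠ 0 := pow_ne_zero e (Fact.out : p.Prime).ne_zero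
  let φ : σ → PowerSeries L := fun l => if l = o then PowerSeries.X else if l = c then -h₁ else 0
  have hφo : φ o = PowerSeries.X := by simp [φ]
  have hφc : φ c = -h₁ := by simp [φ, if_neg hco]
  have hφ0 : ∀ l, PowerSeries.constantCoeff (φ l) = 0 := by
    intro l
    by_cases hlo : l = o
    · simp [φ, hlo]
    · by_cases hlc : l = c
      · rw [hlc, hφc, map_neg, hh, neg_zero]
      · simp [φ, hlo, hlc]
  refine not_isolatedTop_of_approx φ hφ0 (i₀ := o) (by rw [hφo]; exact PowerSeries.X_ne_zero) fun M => ?_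
  set n := M + p ^ e with hn
  set hP : MvPolynomial σ L := ∑ j ∈ Finset.range n, C (PowerSeries.coeff j h₁) * X o ^ j with hhP
  set Rn : MvPolynomial σ L := MvPowerSeries.truncTotal n R with hRn
  set Qn : MvPolynomial σ L := MvPowerSeries.truncTotal n Q with hQn
  refine ⟨(X c + hP) ^ p ^ e * Rn + Qn, fun d hd => ?_, fun α hα0 hαq => ?_⟩
  · -- agreement below degree `n = M + q`
    have hc1 : DegCong n (hP : MvPowerSeries σ L) (PowerSeries.subst (MvPowerSeries.X o : MvPowerSeries σ L) h₁) := by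
      intro d' hd'
      rw [MvPolynomial.coeff_coe, coeff_subst_X_univ, hhP, coeff_sum]
      simp_rw [coeff_C_mul, coeff_X_pow]
      by_cases hdo : d' = Finsupp.single o (d' o)
      · have hdeg : d' o < n := by
          have h2 := hd'
          rw [hdo, Finsupp.degree_single] at h2
          exact h2
        rw [if_pos hdo, Finset.sum_eq_single (d' o), if_pos hdo.symm, mul_one]
        · intro j _ hj
          rw [if_neg, mul_zero]
          intro hdj
          apply hj
          have := congrArg (fun f : σ →₀ ℕ => f o) hdj
          simp only [Finsupp.single_eq_same] at this
          exact this
        · intro hno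
          exact absurd (Finset.mem_range.mpr hdeg) hno
      · rw [if_neg hdo]
        refine Finset.sum_eq_zero fun j _ => ?_
        rw [if_neg, mul_zero]
        intro hdj
        apply hdo
        rw [← hdj, Finsupp.single_eq_same]
    have hcong : DegCong n (((X c + hP) ^ p ^ e * Rn + Qn : MvPolynomial σ L) : MvPowerSeries σ L)
        (G : MvPowerSeries σ L) := by
      rw [hG]
      push_cast
      exact (((DegCong.rfl'.add hc1).pow (p ^ e)).mul (degCong_coe_truncTotal n R)).add (degCong_coe_truncTotal n Q)
    have h3 := hcong d hd
    rw [MvPolynomial.coeff_coe, MvPolynomial.coeff_coe] at h3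
    exact h3.symm
  · -- Hasse part: `∂^{(α)} P = (X_c + h_n)^q ∂^{(α)} R_n`, and the arc sends `X_c + h_n` into `(T^n)`
    have hQn' : ∀ d' ∈ Qn.support, ∀ i, p ^ e ∣ d' i := by
      intro d' hd' i
      by_contra hi
      rw [mem_support_iff, hQn, MvPowerSeries.coeff_truncTotal_eq_ite Q] at hd'
      split_ifs at hd' with hlt
      · exact hd' (hQ.coeff_eq_zero hi)
      · exact hd' rfl
    have hD : hasseDeriv L α ((X c + hP) ^ p ^ e * Rn + Qn) = (X c + hP) ^ p ^ e * hasseDeriv L α Rn := by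
      rw [map_add, hasseDeriv_pow_char_pow_mul (K := L) p e hαq,
        hasseDeriv_eq_zero_of_forall_dvd (K := L) p e hQn' hα0 hαq, add_zero]
    have hval : aeval φ hP = ∑ j ∈ Finset.range n, PowerSeries.C (PowerSeries.coeff j h₁) * PowerSeries.X ^ j := by
      rw [hhP, map_sum]
      refine Finset.sum_congr rfl fun j _ => ?_
      rw [map_mul, map_pow, aeval_C, aeval_X, hφo]
      rfl
    have harc : PowerSeries.X ^ n ∣ aeval φ (X c + hP) := by
      rw [PowerSeries.X_pow_dvd_iff]
      intro m hm
      rw [map_add, aeval_X, hφc, hval, map_add, map_neg, map_sum]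
      simp_rw [PowerSeries.coeff_C_mul, PowerSeries.coeff_X_pow]
      rw [Finset.sum_eq_single m, if_pos rfl, mul_one, neg_add_cancel]
      · intro j _ hj
        rw [if_neg (Ne.symm hj), mul_zero]
      · intro hmn
        exact absurd (Finset.mem_range.mpr hm) hmn
    rw [hD, map_mul, map_pow]
    exact (pow_dvd_pow PowerSeries.X (by omega : M ≤ n)).trans ((dvd_pow harc hq0).mul_right _)

end Engine

end Summit.ResolutionOfSingularities.ResolutionOfSingularities.Theorems.CurveTrap
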